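import Summits.CriticalPhenomena.PercolationContinuityZ3.Theorems.PercNearOneGluingNoHeavyLowerTailThresholdTwoCount

/-!
# `NoHeavyLowerTail` (crux stmt-CriticalPhenomena-4575), lane prim-ineq-gen-4 (gen 17): **THREE-PARTITION POSITIVITY FOR THE THRESHOLD SLOT
# `Θ₂ = {x : 2 ≤ #x}` IN COUNTING FORM, EVERY DIMENSION**

Support file (`--supports stmt-CriticalPhenomena-4575`; memo `run/shared/lean/prim/prim-ineq-gen-4/FINDING-THRESHOLD-FIBREWISE-g17.md`, proof text
`PROOFS-THRESHOLD-TWO-g17.md`).  Pure finite combinatorics, no definitions, no `sorry`, standard axioms.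

THEOREM (`thresholdTwo_counting`).  Let `V, W` be up-sets of finsets of a finite type with `n ≥ 4` points, `∅ ∉ V`, `∅ ∉ W`.  Counting ordered pairs
`(v, w) ∈ V × W` of DISJOINT finsets and pairs `(u, s)` with `u ∈ V ∩ W`, `s` disjoint from `u`:
  `#{(v,w) : 2 ≤ #w} + #{(v,w) : 2 ≤ #v} + #{(u,s) : 2 ≤ #s} ≤ 2·#{(u,s) : 2 ≤ #u} + #{(v,w) : 2 ≤ #(v ∪ w)ᶜ}`.
In the language of the lane's three-partition functional (`ThreePartition.threePartN`; ordered 3-partitions `(S₁,S₂,S₃)`) the five counts are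
`dee(V, Θ₂∩W)`, `dee(W, Θ₂∩V)`, `dee(Θ₂, V∩W)`, `top(Θ₂∩V∩W)` and `tee(Θ₂,V,W)`, so this is `N(Θ₂, V, W) ≥ 0`: THREE-PARTITION POSITIVITY WITH THE
THRESHOLD SLOT `Θ₂` for all up-sets `V, W`, every dimension `n ≥ 4` (the cases `n ≤ 3` and `V = ⊤`/`W = ⊤` are the tree's `threePartN_nonneg_of_card_le_four` /
`threePartN_univ_nonneg`).  `Θ₂` lies in none of the proved strata (comparable pair, cylinder member, independent member, disjoint supports, meet-containing).
The bridge `threePartN {T | 2 ≤ T.ncard} V W = (these finset counts)` (sets of `Set ι` versus finsets) is NOT in this file.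

PROOF = the spectator-by-spectator certificate of PROOFS-THRESHOLD-TWO-g17.md (`fibre_ineq` + the regroupings of `…ThresholdTwoCount`): on each fibre `Y`
the inequality is two graded Kleitmans (`#Yᶜ = 0`), + strict Kleitman (`#Yᶜ = 1`), (RAB₂) (`2 ≤ #Yᶜ ≤ n−2`, `#Y ≥ 3`), the `#Y = 2` lemma, or empty (`#Y ≤ 1`),
with the diagonal weights `ν` of the memo scaled by `n − 1`.
-/

namespace Summit.CriticalPhenomena.PercolationContinuityZ3.Theorems.ThresholdTwoFibre

open Finset

variable {α : Type*} [DecidableEq α] [Fintype α]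

/-! ## The fibre inequality -/

omit [DecidableEq α] [Fintype α] in
/-- Cross pairs in `𝒫(Y)` of size at most `k`: none if `#Y < 2` and the size filter is `2 ≤ ·`. Helper: if every member
of the filtered family has `#z ≤ #Y < 2` the family is empty. [folklore] -/
theorem card_filter_powerset_eq_zero_of_card_lt (Y : Finset α) (Q : Finset α → Prop) [DecidablePred Q]
    (h : ∀ z, z ⊆ Y → Q z → False) : #(Y.powerset.filter Q) = 0 := by
  rw [card_eq_zero, filter_eq_empty_iff]
  intro z hz hq
  exact h z (mem_powerset.1 hz) hq

/-- **The fibre inequality of the certificate.**  For up-sets `W, V` with `∅ ∉ V`, `∅ ∉ W`, `n = card α ≥ 4`, and every `Y`: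
`(n−1)·c₂(Y) + (n−1)·c²(Y) + b(Y)·s(Y) ≤ a(Y)·d₂(Y) + (n−1)·t(Y)` in the notation of the file header. [this work] -/
theorem fibre_ineq (V W : Finset (Finset α)) (hV : IsUpperSet (V : Set (Finset α))) (hW : IsUpperSet (W : Set (Finset α)))
    (hV0 : ∅ ∉ V) (hW0 : ∅ ∉ W) (hn : 4 ≤ Fintype.card α) (Y : Finset α) :
    (Fintype.card α - 1) * #(Y.powerset.filter fun z => (z ∈ W ∧ Y \ z ∈ V) ∧ 2 ≤ #z)
      + (Fintype.card α - 1) * #(Y.powerset.filter fun z => (z ∈ W ∧ Y \ z ∈ V) ∧ 2 ≤ #(Y \ z))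
      + ((if #Yᶜ = 1 then 1 else 0) + (if 2 ≤ #Yᶜ ∧ #Yᶜ ≤ Fintype.card α - 2 then Fintype.card α - 1 else 0))
          * #(Y.powerset.filter fun u => (u ∈ W ∧ u ∈ V) ∧ #u = 1)
    ≤ (Fintype.card α - 1) * (if #Yᶜ ≤ 1 then 2 else 1) * #(Y.powerset.filter fun u => (u ∈ W ∧ u ∈ V) ∧ 2 ≤ #u)
      + (Fintype.card α - 1) * #(Y.powerset.filter fun z => (z ∈ W ∧ Y \ z ∈ V) ∧ 2 ≤ #((Y \ z) ∪ z)ᶜ) := by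
  set n := Fintype.card α with hn'
  set c2 := #(Y.powerset.filter fun z => (z ∈ W ∧ Y \ z ∈ V) ∧ 2 ≤ #z) with hc2
  set cc2 := #(Y.powerset.filter fun z => (z ∈ W ∧ Y \ z ∈ V) ∧ 2 ≤ #(Y \ z)) with hcc2
  set s1 := #(Y.powerset.filter fun u => (u ∈ W ∧ u ∈ V) ∧ #u = 1) with hs1
  set d2 := #(Y.powerset.filter fun u => (u ∈ W ∧ u ∈ V) ∧ 2 ≤ #u) with hd2
  set c := #(Y.powerset.filter fun z => (z ∈ W ∧ Y \ z ∈ V)) with hc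
  have hYc : #Yᶜ = n - #Y := card_compl Y
  have hYle : #Y ≤ n := card_le_univ Y
  -- the `t` term is `c` or `0`
  have ht : #(Y.powerset.filter fun z => (z ∈ W ∧ Y \ z ∈ V) ∧ 2 ≤ #((Y \ z) ∪ z)ᶜ) = if 2 ≤ #Yᶜ then c else 0 := by
    have e : (Y.powerset.filter fun z => (z ∈ W ∧ Y \ z ∈ V) ∧ 2 ≤ #((Y \ z) ∪ z)ᶜ) =
        Y.powerset.filter fun z => (z ∈ W ∧ Y \ z ∈ V) ∧ 2 ≤ #Yᶜ := by
      refine filter_congr fun z hz => ?_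
      rw [mem_powerset] at hz
      rw [sdiff_union_of_subset hz]
    rw [e]
    by_cases h2 : 2 ≤ #Yᶜ
    · rw [if_pos h2]; congr 1; exact filter_congr fun z _ => by simp only [h2, and_true]
    · rw [if_neg h2]; exact card_filter_powerset_eq_zero_of_card_lt Y _ fun z _ hq => h2 hq.2
  rw [ht]
  -- graded Kleitman bounds, always available
  have hGK1 : c2 ≤ d2 := by
    have h := card_cross_two_le Y W V hW hV
    have e : (Y.powerset.filter fun z => (z ∈ W ∧ 2 ≤ #z) ∧ Y \ z ∈ V) = Y.powerset.filter fun z => (z ∈ W ∧ Y \ z ∈ V) ∧ 2 ≤ #z :=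
      filter_congr fun z _ => by tauto
    rw [e] at h; exact h
  have hGK2 : cc2 ≤ d2 := card_cross_cotwo_le Y W V hW hV
  -- the common singletons below `Y`
  have hs1' : s1 = #(Y.filter fun i => ({i} : Finset α) ∈ W ∧ ({i} : Finset α) ∈ V) := card_filter_singletons_eq Y W V
  -- case analysis on `#Yᶜ`
  by_cases h0 : #Yᶜ = 0
  · -- `Y = univ`: two graded Kleitmans
    have e1 : (if #Yᶜ = 1 then 1 else 0) = 0 := by rw [if_neg]; omega
    have e2 : (if 2 ≤ #Yᶜ ∧ #Yᶜ ≤ n - 2 then n - 1 else 0) = 0 := by rw [if_neg]; omega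
    have e3 : (if #Yᶜ ≤ 1 then 2 else 1) = 2 := by rw [if_pos]; omega
    have e4 : (if 2 ≤ #Yᶜ then c else 0) = 0 := by rw [if_neg]; omega
    rw [e1, e2, e3, e4]
    have h2 : (n - 1) * c2 ≤ (n - 1) * d2 := Nat.mul_le_mul_left _ hGK1
    have h3 : (n - 1) * cc2 ≤ (n - 1) * d2 := Nat.mul_le_mul_left _ hGK2
    have e5 : (n - 1) * 2 * d2 = (n - 1) * d2 + (n - 1) * d2 := by ring
    rw [e5]; linarith
  by_cases h1 : #Yᶜ = 1
  · -- `#Y = n − 1 ≥ 3`: graded Kleitmans plus strictness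
    have e1 : (if #Yᶜ = 1 then 1 else 0) = 1 := by rw [if_pos h1]
    have e2 : (if 2 ≤ #Yᶜ ∧ #Yᶜ ≤ n - 2 then n - 1 else 0) = 0 := by rw [if_neg]; omega
    have e3 : (if #Yᶜ ≤ 1 then 2 else 1) = 2 := by rw [if_pos]; omega
    have e4 : (if 2 ≤ #Yᶜ then c else 0) = 0 := by rw [if_neg]; omega
    rw [e1, e2, e3, e4]
    have hY3 : 3 ≤ #Y := by omega
    by_cases hs : s1 = 0
    · rw [hs]
      have h2 : (n - 1) * c2 ≤ (n - 1) * d2 := Nat.mul_le_mul_left _ hGK1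
      have h3 : (n - 1) * cc2 ≤ (n - 1) * d2 := Nat.mul_le_mul_left _ hGK2
      have e5 : (n - 1) * 2 * d2 = (n - 1) * d2 + (n - 1) * d2 := by ring
      rw [e5]; linarith
    · -- a common singleton `{p}` with `p ∈ Y`
      have hs1pos : 0 < #(Y.filter fun i => ({i} : Finset α) ∈ W ∧ ({i} : Finset α) ∈ V) := by
        rw [← hs1']; exact Nat.pos_of_ne_zero hs
      obtain ⟨p, hp⟩ := card_pos.1 hs1pos
      rw [mem_filter] at hp
      have hlt : c2 < d2 := by
        have h := card_cross_two_lt_rel Y W V hW hV hV0 hY3 hp.1 hp.2.1 hp.2.2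
        have e : (Y.powerset.filter fun z => (z ∈ W ∧ 2 ≤ #z) ∧ Y \ z ∈ V) =
            Y.powerset.filter fun z => (z ∈ W ∧ Y \ z ∈ V) ∧ 2 ≤ #z := filter_congr fun z _ => by tauto
        rw [e] at h; exact h
      have hsle : s1 ≤ n - 1 := by
        rw [hs1']; exact (card_le_card (filter_subset _ Y)).trans (by omega)
      have h2 : (n - 1) * (c2 + 1) ≤ (n - 1) * d2 := Nat.mul_le_mul_left _ (Nat.succ_le_of_lt hlt)
      have h3 : (n - 1) * cc2 ≤ (n - 1) * d2 := Nat.mul_le_mul_left _ hGK2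
      have e5 : (n - 1) * 2 * d2 = (n - 1) * d2 + (n - 1) * d2 := by ring
      have e6 : (n - 1) * (c2 + 1) = (n - 1) * c2 + (n - 1) := by ring
      rw [e6] at h2
      rw [e5]; linarith
  by_cases hmid : #Yᶜ ≤ n - 2
  · -- `2 ≤ #Yᶜ ≤ n − 2`, i.e. `2 ≤ #Y ≤ n − 2`
    have h2c : 2 ≤ #Yᶜ := by omega
    have e1 : (if #Yᶜ = 1 then 1 else 0) = 0 := by rw [if_neg h1]
    have e2 : (if 2 ≤ #Yᶜ ∧ #Yᶜ ≤ n - 2 then n - 1 else 0) = n - 1 := by rw [if_pos ⟨h2c, hmid⟩]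
    have e3 : (if #Yᶜ ≤ 1 then 2 else 1) = 1 := by rw [if_neg]; omega
    have e4 : (if 2 ≤ #Yᶜ then c else 0) = c := by rw [if_pos h2c]
    rw [e1, e2, e3, e4, zero_add, mul_one]
    have hY2 : 2 ≤ #Y := by omega
    -- it suffices: c2 + cc2 + s1 ≤ d2 + c
    suffices hkey : c2 + cc2 + s1 ≤ d2 + c by
      have h := Nat.mul_le_mul_left (n - 1) hkey
      have e5 : (n - 1) * (c2 + cc2 + s1) = (n - 1) * c2 + (n - 1) * cc2 + (n - 1) * s1 := by ring
      have e6 : (n - 1) * (d2 + c) = (n - 1) * d2 + (n - 1) * c := by ring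
      rw [e5, e6] at h; exact h
    by_cases hY3 : 3 ≤ #Y
    · -- inclusion–exclusion on the cross family, then (RAB₂)
      set win := #(Y.powerset.filter fun z => (z ∈ W ∧ Y \ z ∈ V) ∧ (2 ≤ #z ∧ #z + 2 ≤ #Y)) with hwin
      have hie : c2 + cc2 ≤ c + win := by
        have eA : (Y.powerset.filter fun z => (z ∈ W ∧ Y \ z ∈ V) ∧ 2 ≤ #z) =
            (Y.powerset.filter fun z => (z ∈ W ∧ Y \ z ∈ V)).filter fun z => 2 ≤ #z := by rw [filter_filter]
        have eB : (Y.powerset.filter fun z => (z ∈ W ∧ Y \ z ∈ V) ∧ 2 ≤ #(Y \ z)) =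
            (Y.powerset.filter fun z => (z ∈ W ∧ Y \ z ∈ V)).filter fun z => 2 ≤ #(Y \ z) := by rw [filter_filter]
        have eW : (Y.powerset.filter fun z => (z ∈ W ∧ Y \ z ∈ V) ∧ (2 ≤ #z ∧ #z + 2 ≤ #Y)) =
            ((Y.powerset.filter fun z => (z ∈ W ∧ Y \ z ∈ V)).filter fun z => 2 ≤ #z) ∩
              ((Y.powerset.filter fun z => (z ∈ W ∧ Y \ z ∈ V)).filter fun z => 2 ≤ #(Y \ z)) := by
          rw [← filter_and, filter_filter]
          refine filter_congr fun z hz => ?_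
          rw [mem_powerset] at hz
          rw [card_sdiff_of_subset hz]
          constructor
          · rintro ⟨h, ha, hb⟩; exact ⟨h, ha, by omega⟩
          · rintro ⟨h, ha, hb⟩; have := card_le_card hz; exact ⟨h, ha, by omega⟩
        have hu := card_union_add_card_inter
          ((Y.powerset.filter fun z => (z ∈ W ∧ Y \ z ∈ V)).filter fun z => 2 ≤ #z)
          ((Y.powerset.filter fun z => (z ∈ W ∧ Y \ z ∈ V)).filter fun z => 2 ≤ #(Y \ z))
        have hsub : ((Y.powerset.filter fun z => (z ∈ W ∧ Y \ z ∈ V)).filter fun z => 2 ≤ #z) ∪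
            ((Y.powerset.filter fun z => (z ∈ W ∧ Y \ z ∈ V)).filter fun z => 2 ≤ #(Y \ z))
            ⊆ Y.powerset.filter fun z => (z ∈ W ∧ Y \ z ∈ V) :=
          union_subset (filter_subset _ _) (filter_subset _ _)
        have h4 := card_le_card hsub
        rw [hc2, hcc2, hwin, hc, eA, eB, eW]
        omega
      have hrab := card_window_add_singletons_le_rel Y W V hW hV hY3
      rw [← hs1'] at hrab
      omega
    · -- `#Y = 2`
      have hY2' : #Y = 2 := by omega
      have hc2z : c2 = 0 := by
        rw [hc2]; refine card_filter_powerset_eq_zero_of_card_lt Y _ fun z hz hq => ?_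
        have hzY : z = Y := eq_of_subset_of_card_le hz (by have := card_le_card hz; omega)
        apply hV0
        have : Y \ z = ∅ := by rw [hzY, Finset.sdiff_self]
        rw [← this]; exact hq.1.2
      have hcc2z : cc2 = 0 := by
        rw [hcc2]; refine card_filter_powerset_eq_zero_of_card_lt Y _ fun z hz hq => ?_
        have h' : #(Y \ z) = #Y - #z := card_sdiff_of_subset hz
        have hz0 : #z = 0 := by omega
        rw [card_eq_zero] at hz0
        exact hW0 (hz0 ▸ hq.1.1)
      have hf2 := card_singletons_le_two_fibre Y W V hW hV hY2'
      rw [← hs1'] at hf2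
      have hle : #(Y.powerset.filter fun z => (z ∈ W ∧ Y \ z ∈ V) ∧ #z = 1) ≤ c :=
        card_le_card (fun z hz => by rw [mem_filter] at hz ⊢; exact ⟨hz.1, hz.2.1⟩)
      omega
  · -- `#Yᶜ ≥ n − 1`, i.e. `#Y ≤ 1`: everything on the left vanishes
    have e1 : (if #Yᶜ = 1 then 1 else 0) = 0 := by rw [if_neg h1]
    have e2 : (if 2 ≤ #Yᶜ ∧ #Yᶜ ≤ n - 2 then n - 1 else 0) = 0 := by rw [if_neg]; omega
    rw [e1, e2, zero_add, zero_mul, add_zero]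
    have hY1 : #Y ≤ 1 := by omega
    have hc2z : c2 = 0 := by
      rw [hc2]; exact card_filter_powerset_eq_zero_of_card_lt Y _ fun z hz hq => by
        have := card_le_card hz; omega
    have hcc2z : cc2 = 0 := by
      rw [hcc2]; exact card_filter_powerset_eq_zero_of_card_lt Y _ fun z hz hq => by
        have := card_le_card (sdiff_subset : Y \ z ⊆ Y); omega
    rw [hc2z, hcc2z]; simp

/-! ## The theorem -/

/-- **Three-partition positivity for the threshold slot `Θ₂`, counting form.**  For up-sets `V, W` of the finsets of a finite type with
`n ≥ 4` points, `∅ ∉ V`, `∅ ∉ W`: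
`#{(v,w) : 2 ≤ #w} + #{(v,w) : 2 ≤ #v} + #{(u,s) : 2 ≤ #s} ≤ 2·#{(u,s) : 2 ≤ #u} + #{(v,w) : 2 ≤ #(v ∪ w)ᶜ}`
over pairs `(v,w) ∈ V × W` of disjoint finsets and pairs `(u,s)`, `u ∈ V ∩ W`, `s` disjoint from `u`
(`= dee(V,Θ₂∩W) + dee(W,Θ₂∩V) + dee(Θ₂,V∩W) ≤ 2·top(Θ₂∩V∩W) + tee(Θ₂,V,W)`, i.e. `N(Θ₂,V,W) ≥ 0`). [this work] -/
theorem thresholdTwo_counting (V W : Finset (Finset α)) (hV : IsUpperSet (V : Set (Finset α)))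
    (hW : IsUpperSet (W : Set (Finset α))) (hV0 : ∅ ∉ V) (hW0 : ∅ ∉ W) (hn : 4 ≤ Fintype.card α) :
    #((univ : Finset (Finset α × Finset α)).filter fun q => (q.1 ∈ V ∧ q.2 ∈ W ∧ Disjoint q.1 q.2) ∧ 2 ≤ #q.2)
      + #((univ : Finset (Finset α × Finset α)).filter fun q => (q.1 ∈ V ∧ q.2 ∈ W ∧ Disjoint q.1 q.2) ∧ 2 ≤ #q.1)
      + #((univ : Finset (Finset α × Finset α)).filter fun q => ((q.1 ∈ V ∧ q.1 ∈ W) ∧ Disjoint q.1 q.2) ∧ 2 ≤ #q.2)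
    ≤ 2 * #((univ : Finset (Finset α × Finset α)).filter fun q => ((q.1 ∈ V ∧ q.1 ∈ W) ∧ Disjoint q.1 q.2) ∧ 2 ≤ #q.1)
      + #((univ : Finset (Finset α × Finset α)).filter fun q =>
          (q.1 ∈ V ∧ q.2 ∈ W ∧ Disjoint q.1 q.2) ∧ 2 ≤ #(q.1 ∪ q.2)ᶜ) := by
  have hn1 : 0 < Fintype.card α - 1 := by omega
  have eBw := card_crossPairs_eq_sum V W (fun q => 2 ≤ #q.2)
  have eBv := card_crossPairs_eq_sum V W (fun q => 2 ≤ #q.1)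
  have eBt := card_crossPairs_eq_sum V W (fun q => 2 ≤ #(q.1 ∪ q.2)ᶜ)
  have eP2a := card_diagPairs_eq_sum V W (fun q => 2 ≤ #q.1)
  have eP2b := card_diagPairs_eq_sum V W (fun q => 2 ≤ #q.1 ∧ #q.2 ≤ 1)
  have eC1a := card_diagPairs_eq_sum V W (fun q => #q.1 = 1 ∧ #q.2 = 1)
  have eC1b := card_diagPairs_eq_sum V W (fun q => #q.1 = 1 ∧ (2 ≤ #q.2 ∧ #q.2 ≤ Fintype.card α - 2))
  have hsing := singleton_pairs_identity V W
  dsimp only at eBw eBv eBt eP2a eP2b eC1a eC1b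
  -- splits of the diagonal counts
  have sP2 : #((univ : Finset (Finset α × Finset α)).filter fun q => ((q.1 ∈ V ∧ q.1 ∈ W) ∧ Disjoint q.1 q.2) ∧ 2 ≤ #q.1)
      = #((univ : Finset (Finset α × Finset α)).filter fun q => ((q.1 ∈ V ∧ q.1 ∈ W) ∧ Disjoint q.1 q.2) ∧ (2 ≤ #q.1 ∧ #q.2 ≤ 1))
      + #((univ : Finset (Finset α × Finset α)).filter fun q => ((q.1 ∈ V ∧ q.1 ∈ W) ∧ Disjoint q.1 q.2) ∧ (2 ≤ #q.1 ∧ 2 ≤ #q.2)) := by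
    rw [card_filter_split _ _ (fun q : Finset α × Finset α => #q.2 ≤ 1)]
    congr 1
    · exact congrArg _ (filter_congr fun q _ => by tauto)
    · refine congrArg _ (filter_congr fun q _ => ?_)
      constructor
      · rintro ⟨⟨h, h1⟩, h2⟩; exact ⟨h, h1, by omega⟩
      · rintro ⟨h, h1, h2⟩; exact ⟨⟨h, h1⟩, by omega⟩
  have sC : #((univ : Finset (Finset α × Finset α)).filter fun q => ((q.1 ∈ V ∧ q.1 ∈ W) ∧ Disjoint q.1 q.2) ∧ 2 ≤ #q.2)
      = #((univ : Finset (Finset α × Finset α)).filter fun q => ((q.1 ∈ V ∧ q.1 ∈ W) ∧ Disjoint q.1 q.2) ∧ (#q.1 = 1 ∧ 2 ≤ #q.2))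
      + #((univ : Finset (Finset α × Finset α)).filter fun q => ((q.1 ∈ V ∧ q.1 ∈ W) ∧ Disjoint q.1 q.2) ∧ (2 ≤ #q.1 ∧ 2 ≤ #q.2)) := by
    rw [card_filter_split _ _ (fun q : Finset α × Finset α => #q.1 = 1)]
    congr 1
    · exact congrArg _ (filter_congr fun q _ => by tauto)
    · refine congrArg _ (filter_congr fun q _ => ?_)
      have hne : ∀ u : Finset α, u ∈ V → 1 ≤ #u := fun u hu => by
        rw [Nat.one_le_iff_ne_zero, Ne, card_eq_zero]; rintro rfl; exact hV0 hu
      constructor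
      · rintro ⟨⟨h, h1⟩, h2⟩; have := hne _ h.1.1; exact ⟨h, by omega, h1⟩
      · rintro ⟨h, h1, h2⟩; exact ⟨⟨h, h2⟩, by omega⟩
  have sC1 : #((univ : Finset (Finset α × Finset α)).filter fun q => ((q.1 ∈ V ∧ q.1 ∈ W) ∧ Disjoint q.1 q.2) ∧ (#q.1 = 1 ∧ 2 ≤ #q.2))
      = #((univ : Finset (Finset α × Finset α)).filter fun q => ((q.1 ∈ V ∧ q.1 ∈ W) ∧ Disjoint q.1 q.2) ∧ (#q.1 = 1 ∧ (2 ≤ #q.2 ∧ #q.2 ≤ Fintype.card α - 2)))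
      + #((univ : Finset (Finset α × Finset α)).filter fun q => ((q.1 ∈ V ∧ q.1 ∈ W) ∧ Disjoint q.1 q.2) ∧ (#q.1 = 1 ∧ Fintype.card α - 1 ≤ #q.2)) := by
    rw [card_filter_split _ _ (fun q : Finset α × Finset α => #q.2 ≤ Fintype.card α - 2)]
    congr 1
    · exact congrArg _ (filter_congr fun q _ => by tauto)
    · refine congrArg _ (filter_congr fun q _ => ?_)
      constructor
      · rintro ⟨⟨h, h1, h2⟩, h3⟩; exact ⟨h, h1, by omega⟩
      · rintro ⟨h, h1, h2⟩; exact ⟨⟨h, h1, by omega⟩, by omega⟩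
  -- the fibre inequality summed over all fibres
  have hsum := Finset.sum_le_sum fun Y (_ : Y ∈ (univ : Finset (Finset α))) => fibre_ineq V W hV hW hV0 hW0 hn Y
  -- evaluate the `if`-weighted sums
  have tA : ∀ Y : Finset α, ((if #Yᶜ = 1 then 1 else 0) + (if 2 ≤ #Yᶜ ∧ #Yᶜ ≤ Fintype.card α - 2 then Fintype.card α - 1 else 0))
        * #(Y.powerset.filter fun u => (u ∈ W ∧ u ∈ V) ∧ #u = 1)
      = #(Y.powerset.filter fun u => (u ∈ W ∧ u ∈ V) ∧ (#u = 1 ∧ #Yᶜ = 1))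
        + (Fintype.card α - 1) * #(Y.powerset.filter fun u => (u ∈ W ∧ u ∈ V) ∧ (#u = 1 ∧ (2 ≤ #Yᶜ ∧ #Yᶜ ≤ Fintype.card α - 2))) := by
    intro Y
    by_cases hA : #Yᶜ = 1
    · have hB : ¬ (2 ≤ #Yᶜ ∧ #Yᶜ ≤ Fintype.card α - 2) := by omega
      rw [if_pos hA, if_neg hB, add_zero, one_mul]
      have e1 : (Y.powerset.filter fun u => (u ∈ W ∧ u ∈ V) ∧ (#u = 1 ∧ #Yᶜ = 1))
          = Y.powerset.filter fun u => (u ∈ W ∧ u ∈ V) ∧ #u = 1 := filter_congr fun u _ => by simp only [hA, and_true]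
      have e2 : (Y.powerset.filter fun u => (u ∈ W ∧ u ∈ V) ∧ (#u = 1 ∧ (2 ≤ #Yᶜ ∧ #Yᶜ ≤ Fintype.card α - 2))) = ∅ :=
        filter_eq_empty_iff.2 fun u _ h => hB h.2.2
      rw [e1, e2, card_empty, mul_zero, add_zero]
    · by_cases hB : (2 ≤ #Yᶜ ∧ #Yᶜ ≤ Fintype.card α - 2)
      · rw [if_neg hA, if_pos hB, zero_add]
        have e1 : (Y.powerset.filter fun u => (u ∈ W ∧ u ∈ V) ∧ (#u = 1 ∧ #Yᶜ = 1)) = ∅ :=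
          filter_eq_empty_iff.2 fun u _ h => hA h.2.2
        have e2 : (Y.powerset.filter fun u => (u ∈ W ∧ u ∈ V) ∧ (#u = 1 ∧ (2 ≤ #Yᶜ ∧ #Yᶜ ≤ Fintype.card α - 2)))
            = Y.powerset.filter fun u => (u ∈ W ∧ u ∈ V) ∧ #u = 1 := filter_congr fun u _ => by simp only [hB, and_self, and_true]
        rw [e1, e2, card_empty, zero_add]
      · rw [if_neg hA, if_neg hB, zero_add, zero_mul]
        have e1 : (Y.powerset.filter fun u => (u ∈ W ∧ u ∈ V) ∧ (#u = 1 ∧ #Yᶜ = 1)) = ∅ :=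
          filter_eq_empty_iff.2 fun u _ h => hA h.2.2
        have e2 : (Y.powerset.filter fun u => (u ∈ W ∧ u ∈ V) ∧ (#u = 1 ∧ (2 ≤ #Yᶜ ∧ #Yᶜ ≤ Fintype.card α - 2))) = ∅ :=
          filter_eq_empty_iff.2 fun u _ h => hB h.2.2
        rw [e1, e2, card_empty, mul_zero, add_zero]
  have tB : ∀ Y : Finset α, (Fintype.card α - 1) * (if #Yᶜ ≤ 1 then 2 else 1) * #(Y.powerset.filter fun u => (u ∈ W ∧ u ∈ V) ∧ 2 ≤ #u)
      = (Fintype.card α - 1) * #(Y.powerset.filter fun u => (u ∈ W ∧ u ∈ V) ∧ 2 ≤ #u)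
        + (Fintype.card α - 1) * #(Y.powerset.filter fun u => (u ∈ W ∧ u ∈ V) ∧ (2 ≤ #u ∧ #Yᶜ ≤ 1)) := by
    intro Y
    by_cases hC : #Yᶜ ≤ 1
    · rw [if_pos hC]
      have e1 : (Y.powerset.filter fun u => (u ∈ W ∧ u ∈ V) ∧ (2 ≤ #u ∧ #Yᶜ ≤ 1))
          = Y.powerset.filter fun u => (u ∈ W ∧ u ∈ V) ∧ 2 ≤ #u := filter_congr fun u _ => by simp only [hC, and_true]
      rw [e1]; ring
    · rw [if_neg hC, mul_one]
      have e1 : (Y.powerset.filter fun u => (u ∈ W ∧ u ∈ V) ∧ (2 ≤ #u ∧ #Yᶜ ≤ 1)) = ∅ :=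
        filter_eq_empty_iff.2 fun u _ h => hC h.2.2
      rw [e1, card_empty, mul_zero, add_zero]
  have hC : ∑ Y : Finset α, ((if #Yᶜ = 1 then 1 else 0) + (if 2 ≤ #Yᶜ ∧ #Yᶜ ≤ Fintype.card α - 2 then Fintype.card α - 1 else 0))
        * #(Y.powerset.filter fun u => (u ∈ W ∧ u ∈ V) ∧ #u = 1)
      = ∑ Y : Finset α, #(Y.powerset.filter fun u => (u ∈ W ∧ u ∈ V) ∧ (#u = 1 ∧ #Yᶜ = 1))
        + (Fintype.card α - 1) * ∑ Y : Finset α, #(Y.powerset.filter fun u => (u ∈ W ∧ u ∈ V) ∧ (#u = 1 ∧ (2 ≤ #Yᶜ ∧ #Yᶜ ≤ Fintype.card α - 2))) := by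
    rw [sum_congr rfl fun Y _ => tA Y, sum_add_distrib, ← Finset.mul_sum]
  have hD : ∑ Y : Finset α, (Fintype.card α - 1) * (if #Yᶜ ≤ 1 then 2 else 1) * #(Y.powerset.filter fun u => (u ∈ W ∧ u ∈ V) ∧ 2 ≤ #u)
      = (Fintype.card α - 1) * ∑ Y : Finset α, #(Y.powerset.filter fun u => (u ∈ W ∧ u ∈ V) ∧ 2 ≤ #u)
        + (Fintype.card α - 1) * ∑ Y : Finset α, #(Y.powerset.filter fun u => (u ∈ W ∧ u ∈ V) ∧ (2 ≤ #u ∧ #Yᶜ ≤ 1)) := by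
    rw [sum_congr rfl fun Y _ => tB Y, sum_add_distrib, ← Finset.mul_sum, ← Finset.mul_sum]
  rw [sum_add_distrib, sum_add_distrib, sum_add_distrib, hC, hD, ← Finset.mul_sum, ← Finset.mul_sum, ← Finset.mul_sum] at hsum
  rw [← eBw, ← eBv, ← eBt, ← eP2a, ← eP2b, ← eC1a, ← eC1b] at hsum
  rw [sP2, sC, sC1]
  rw [sP2] at hsum
  have key : (Fintype.card α - 1) * (#((univ : Finset (Finset α × Finset α)).filter fun q => (q.1 ∈ V ∧ q.2 ∈ W ∧ Disjoint q.1 q.2) ∧ 2 ≤ #q.2)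
      + #((univ : Finset (Finset α × Finset α)).filter fun q => (q.1 ∈ V ∧ q.2 ∈ W ∧ Disjoint q.1 q.2) ∧ 2 ≤ #q.1)
      + (#((univ : Finset (Finset α × Finset α)).filter fun q => ((q.1 ∈ V ∧ q.1 ∈ W) ∧ Disjoint q.1 q.2) ∧ (#q.1 = 1 ∧ (2 ≤ #q.2 ∧ #q.2 ≤ Fintype.card α - 2)))
        + #((univ : Finset (Finset α × Finset α)).filter fun q => ((q.1 ∈ V ∧ q.1 ∈ W) ∧ Disjoint q.1 q.2) ∧ (#q.1 = 1 ∧ Fintype.card α - 1 ≤ #q.2))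
        + #((univ : Finset (Finset α × Finset α)).filter fun q => ((q.1 ∈ V ∧ q.1 ∈ W) ∧ Disjoint q.1 q.2) ∧ (2 ≤ #q.1 ∧ 2 ≤ #q.2))))
    ≤ (Fintype.card α - 1) * (2 * (#((univ : Finset (Finset α × Finset α)).filter fun q => ((q.1 ∈ V ∧ q.1 ∈ W) ∧ Disjoint q.1 q.2) ∧ (2 ≤ #q.1 ∧ #q.2 ≤ 1))
        + #((univ : Finset (Finset α × Finset α)).filter fun q => ((q.1 ∈ V ∧ q.1 ∈ W) ∧ Disjoint q.1 q.2) ∧ (2 ≤ #q.1 ∧ 2 ≤ #q.2)))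
      + #((univ : Finset (Finset α × Finset α)).filter fun q =>
          (q.1 ∈ V ∧ q.2 ∈ W ∧ Disjoint q.1 q.2) ∧ 2 ≤ #(q.1 ∪ q.2)ᶜ)) := by
    linarith [hsum, hsing]
  exact Nat.le_of_mul_le_mul_left key hn1

end Summit.CriticalPhenomena.PercolationContinuityZ3.Theorems.ThresholdTwoFibre
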